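import Literature.AlgebraicGeometry.AbelianSchemes.AbelianSchemeQuotientDescentCharacter
import Literature.AlgebraicGeometry.Morphisms.RootOfUnityRigidConnected
import Literature.AlgebraicGeometry.Modules.RankOneDescentAlongH0Iso
import Literature.AlgebraicGeometry.Modules.DetClassOfIso
import HarnessLib

/-!
# A line bundle on `(A/K)_T` trivial on `A_T` and on one fibre is trivial (HECKE-LINK D6, stub (K4) «character step», part 2)

Layer `Literature/AlgebraicGeometry/AbelianSchemes`, namespace `Literature.AlgebraicGeometry.AbelianSchemes.AbelianSchemeOver`.
THEOREMS ONLY (no definition, no named fact, no instance).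

Setting ([MumfordAV1970] §7 Thm. 4, §12 Thm. 1, §15 Thm. 1): `A/S` an abelian scheme, `K ⊆ A(S)` a finite group of
sections acting freely by translations, killed by `n` (`hK`); `ψ : A → A/K` the quotient (★ `AbelianSchemeConstSubgroupQuotient`)
and, for a test base `T′ → S`, its base change `ψ_T : A_T → (A/K)_T` — a free affine flat geometric quotient for the
`K`-translations (★ (u0) `AbelianSchemeQuotientBaseChangeAction`).  Let `M` be a line bundle on `(A/K)_T` with
`τ : ψ_T^* M ≅ 𝒪_{A_T}`.  By descent along `ψ_T` ([MumfordAV1970] §12 Thm. 1; the kernel of `Pic (A/K)_T → Pic A_T` is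
`Hom(K, Γ(T, 𝒪_T)ˣ)`, [MumfordAV1970] §15, §23) the class of `M` is the CHARACTER `σ ↦ a_σ` by which `K` acts on the
generator `s = τ⁻¹(1)` of `ψ_T^* M`; its values are `n`-th roots of unity in `Γ(A_T, 𝒪) = Γ(T, 𝒪)` (Stein, ★
`AbelianSchemeSteinOfReduced`, `T` reduced).  If `M` is trivial on ONE fibre `(A/K)_k`, the character is `1` at that
point (the canonical linearisation of a trivial module has no twist, ★ `DescentOfUnitAlongFreeQuotient` §3–§4), hence
`1` on the CONNECTED `T` (★ `RootOfUnityRigidConnected`), hence `M ≅ 𝒪` (★ `DescentOfUnitAlongFreeQuotient` §2).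

Part 1 (★ `AbelianSchemeQuotientDescentCharacter`): `K` fixes `Γ(A_T, 𝒪)`, the generator `s = τ⁻¹(1)` of `ψ_T^* M` is an
eigen-section `g · s = a_g · s` with `a_g ^ n = 1`.  Here:
* §2 the fibre: along `A_k → A_T` the eigenvalue restricts (★ `actSections_squareIso_unitSection`) and is `1` if
  `M|_{(A/K)_k}` is trivial (★ `actSections_ofPullback_eq_self_of_iso_unit`, ★ Stein on `A_k`);
* §3 **`nonempty_iso_unit_of_pullback_quotientMk_iso_unit`** — the statement above, for `T′` connected, reduced, locally
  Noetherian with `n` invertible (HECKE-LINK (K4); feeds the hypothesis `hChar` of ★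
  `PoincarePullbackStabilizerConstant.stabilizer_le_of_torsion_of_character` through (K5b), at
  `M := (1 × (f ≫ σ_c))^*𝒩₁`, `𝒩₁ = (π × 1)^*𝒫`);
* §4 `nonempty_iso_unit_of_pullback_quotientMk_iso_unit_of_nonempty` — the same with the fibre hypothesis replaced by
  triviality over any NON-EMPTY `U → T′`.

Cell `hodgecm-mathlib` (D-0151), HECKE-LINK line card v1.2 / B-plan1 (g14) 21:39:01Z (P2) (K4).  Count-neutral; HC_CM is
proved only modulo the 7 printed citations until rung 0 closes — nothing here is about HC.

## References
* [MumfordAV1970] D. Mumford, *Abelian Varieties* (1970), §7 Thm. 4 (p. 72), §12 Thm. 1 (p. 112), §15 Thm. 1 (p. 143).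
* [MilneAV2008] J. S. Milne, *Abelian Varieties* (2008), I §8 (pp. 36–37), I §9 Thm. 9.1 (p. 42).
* [SGA1] A. Grothendieck, SGA 1, Exp. I Cor. 5.4 (rigidity of étale sections).
-/

set_option autoImplicit false

noncomputable section

-- `(A.X ⊗ T′).left = pullback A.X.hom T′.hom = (A.baseChange T′.hom).left` hold by `rfl` only.
set_option backward.isDefEq.respectTransparency false

universe u

open CategoryTheory CategoryTheory.Limits AlgebraicGeometry MonoidalCategory CartesianMonoidalCategory TopologicalSpace
  Opposite
open scoped MonObj

namespace Literature.AlgebraicGeometry.AbelianSchemes.AbelianSchemeOver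

open Literature.AlgebraicGeometry.RelativeSpec Literature.AlgebraicGeometry.Modules Literature.AlgebraicGeometry.Motives
  Literature.AlgebraicGeometry.HodgeTheory Literature.AlgebraicGeometry.Morphisms

variable {S : Scheme.{u}} (A : AbelianSchemeOver S) (T' : Over S) {Y : Scheme.{u}} (u : S ⟶ Y)
  (K : Subgroup A.Sections) {n : ℕ} (hK : ∀ σ : K, (σ : A.Sections) ^ n = 1)
  [Finite K] [Y.IsSeparated] [IsSeparated (A.X.hom ≫ u)] [S.IsSeparated]
  (hcov : ∀ x : A.left, ∃ O : (A.translationActionOver u K).StableAffineOpens, x ∈ O.1)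
  (hfree : ∀ (Ω : Type u) [Field Ω] [IsAlgClosed Ω] (x : Spec (.of Ω) ⟶ A.left) (σ : K), σ ≠ 1 →
    x ≫ (A.translation (σ : A.Sections)).left ≠ x)

/-! ## §2 The fibre over a field-valued point `x : Spec k → T′` -/

section Point

variable (M : ((A.quotientOver u K ⊗ T').left).Modules)
  (τ : (Scheme.Modules.pullback (A.quotientMk u K hcov ▷ T').left).obj M ≅ SheafOfModules.unit _)
  {k : Type u} [Field k] (x : Spec (.of k) ⟶ T'.left)

/-- The base-change square `A_k → A_T` over `(A/K)_k → (A/K)_T` commutes with `ψ` (monoidal `whisker_exchange` in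
`Over S`). [cite: MumfordAV1970, §7 Thm. 4 (p. 72)] -/
theorem whiskerLeft_left_comp_whiskerRight_quotientMk_left :
    (A.X ◁ (Over.homMk x rfl : Over.mk (x ≫ T'.hom) ⟶ T')).left ≫ (A.quotientMk u K hcov ▷ T').left =
      (A.quotientMk u K hcov ▷ Over.mk (x ≫ T'.hom)).left ≫
        (A.quotientOver u K ◁ (Over.homMk x rfl : Over.mk (x ≫ T'.hom) ⟶ T')).left := by
  rw [← Over.comp_left, ← Over.comp_left, whisker_exchange]

/-- The base-change map `A_k → A_T` is `K`-equivariant for the translation actions. [cite: MumfordAV1970, §7 Thm. 4 (p. 72)] -/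
theorem translationWhiskerRight_comp_whiskerLeft_left (g : K) :
    (translationActionOverWhiskerRight A (Over.mk (x ≫ T'.hom)) u K hcov).autHom g ≫
        (A.X ◁ (Over.homMk x rfl : Over.mk (x ≫ T'.hom) ⟶ T')).left =
      (A.X ◁ (Over.homMk x rfl : Over.mk (x ≫ T'.hom) ⟶ T')).left ≫
        (translationActionOverWhiskerRight A T' u K hcov).autHom g := by
  change (A.translation (g : A.Sections) ▷ Over.mk (x ≫ T'.hom)).left ≫ _ =
    _ ≫ (A.translation (g : A.Sections) ▷ T').left
  rw [← Over.comp_left, ← Over.comp_left, whisker_exchange]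

/-- `A_k → A_T → (A/K)_T → T′ = (A_k → Spec k) ≫ x`. [cite: MumfordAV1970, §7 Thm. 4 (p. 72)] -/
theorem whiskerLeft_left_comp_comp_snd :
    (A.X ◁ (Over.homMk x rfl : Over.mk (x ≫ T'.hom) ⟶ T')).left ≫ (A.quotientMk u K hcov ▷ T').left ≫
        pullback.snd (A.quotientOver u K).hom T'.hom =
      pullback.snd A.X.hom (x ≫ T'.hom) ≫ x := by
  rw [Over.whiskerRight_left_snd, Over.whiskerLeft_left_snd]
  rfl

include hcov in
/-- **Step 1 at the point: the restricted generator is fixed AND scaled by `ι^♯(a)`.**  Along `ι : A_k → A_T` the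
eigen-relation `g · s = a · s` restricts to `g · s′ = ι^♯(a) · s′` (★ `actSections_squareIso_unitSection`), while on
`A_k` every section of `ψ_k^*(M|)` is fixed when `M|_{(A/K)_k}` is trivial (★ `actSections_ofPullback_eq_self_of_iso_unit`;
`K` fixes `Γ(A_k, 𝒪) = k` by ★ Stein); hence `s′ = ι^♯(a) · s′`. [cite: MumfordAV1970, §12 Thm. 1 (p. 112)] -/
theorem squareIso_unitSection_eq_smul (hM : HasRank M 1) (g : K) (ζ : Γ(T'.left, ⊤))
    (hζ : (translationActionOverWhiskerRight A T' u K hcov).actSections _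
        (ActionOver.EquivariantStructure.ofPullback (translationActionOverWhiskerRight A T' u K hcov) M).iso g ⊤
        (τ.inv.app ((A.quotientMk u K hcov ▷ T').left ⁻¹ᵁ ⊤)
            (1 : Γ((A.X ⊗ T').left, (A.quotientMk u K hcov ▷ T').left ⁻¹ᵁ ⊤))) =
      (A.quotientMk u K hcov ▷ T').left.app ⊤ ((pullback.snd (A.quotientOver u K).hom T'.hom).appTop ζ) •
        (τ.inv.app ((A.quotientMk u K hcov ▷ T').left ⁻¹ᵁ ⊤)
            (1 : Γ((A.X ⊗ T').left, (A.quotientMk u K hcov ▷ T').left ⁻¹ᵁ ⊤))))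
    (hx : Nonempty ((Scheme.Modules.pullback
      (A.quotientOver u K ◁ (Over.homMk x rfl : Over.mk (x ≫ T'.hom) ⟶ T')).left).obj M ≅ SheafOfModules.unit _)) :
    ((squareIso (A.whiskerLeft_left_comp_whiskerRight_quotientMk_left T' u K hcov x) M).hom.app
        ((A.quotientMk u K hcov ▷ Over.mk (x ≫ T'.hom)).left ⁻¹ᵁ ⊤)
        (Literature.AlgebraicGeometry.Modules.unitSection (A.X ◁ (Over.homMk x rfl : Over.mk (x ≫ T'.hom) ⟶ T')).left _
          ((A.quotientMk u K hcov ▷ T').left ⁻¹ᵁ ⊤) (τ.inv.app ((A.quotientMk u K hcov ▷ T').left ⁻¹ᵁ ⊤)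
            (1 : Γ((A.X ⊗ T').left, (A.quotientMk u K hcov ▷ T').left ⁻¹ᵁ ⊤))))) =
      (Scheme.Hom.appLE (A.X ◁ (Over.homMk x rfl : Over.mk (x ≫ T'.hom) ⟶ T')).left
        ((A.quotientMk u K hcov ▷ T').left ⁻¹ᵁ ⊤) ((A.quotientMk u K hcov ▷ Over.mk (x ≫ T'.hom)).left ⁻¹ᵁ ⊤) (le_of_eq rfl)
        ((A.quotientMk u K hcov ▷ T').left.app ⊤ ((pullback.snd (A.quotientOver u K).hom T'.hom).appTop ζ))) •
      ((squareIso (A.whiskerLeft_left_comp_whiskerRight_quotientMk_left T' u K hcov x) M).hom.app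
        ((A.quotientMk u K hcov ▷ Over.mk (x ≫ T'.hom)).left ⁻¹ᵁ ⊤)
        (Literature.AlgebraicGeometry.Modules.unitSection (A.X ◁ (Over.homMk x rfl : Over.mk (x ≫ T'.hom) ⟶ T')).left _
          ((A.quotientMk u K hcov ▷ T').left ⁻¹ᵁ ⊤) (τ.inv.app ((A.quotientMk u K hcov ▷ T').left ⁻¹ᵁ ⊤)
            (1 : Γ((A.X ⊗ T').left, (A.quotientMk u K hcov ▷ T').left ⁻¹ᵁ ⊤))))) := by
  obtain ⟨β⟩ := hx
  haveI : IsReduced (Over.mk (x ≫ T'.hom)).left := inferInstanceAs (IsReduced (Spec (.of k)))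
  haveI : IsLocallyNoetherian (Over.mk (x ≫ T'.hom)).left := inferInstanceAs (IsLocallyNoetherian (Spec (.of k)))
  have hF : IsFiniteLocallyFree M := HasRank.isFiniteLocallyFree' hM
  have h1 := ActionOver.actSections_squareIso_unitSection (translationActionOverWhiskerRight A T' u K hcov)
    (translationActionOverWhiskerRight A (Over.mk (x ≫ T'.hom)) u K hcov)
    (A.X ◁ (Over.homMk x rfl : Over.mk (x ≫ T'.hom) ⟶ T')).left
    (A.quotientOver u K ◁ (Over.homMk x rfl : Over.mk (x ≫ T'.hom) ⟶ T')).left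
    (A.whiskerLeft_left_comp_whiskerRight_quotientMk_left T' u K hcov x)
    (A.translationWhiskerRight_comp_whiskerLeft_left T' u K hcov x) hF g _ _ hζ
  have h2 := ActionOver.actSections_ofPullback_eq_self_of_iso_unit
    (translationActionOverWhiskerRight A (Over.mk (x ≫ T'.hom)) u K hcov) _ β g ⊤
    (A.appLE_translationWhiskerRight_eq_self (Over.mk (x ≫ T'.hom)) u K hcov g)
    ((squareIso (A.whiskerLeft_left_comp_whiskerRight_quotientMk_left T' u K hcov x) M).hom.app
        ((A.quotientMk u K hcov ▷ Over.mk (x ≫ T'.hom)).left ⁻¹ᵁ ⊤)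
        (Literature.AlgebraicGeometry.Modules.unitSection (A.X ◁ (Over.homMk x rfl : Over.mk (x ≫ T'.hom) ⟶ T')).left _
          ((A.quotientMk u K hcov ▷ T').left ⁻¹ᵁ ⊤) (τ.inv.app ((A.quotientMk u K hcov ▷ T').left ⁻¹ᵁ ⊤)
            (1 : Γ((A.X ⊗ T').left, (A.quotientMk u K hcov ▷ T').left ⁻¹ᵁ ⊤)))))
  rw [h2] at h1
  exact h1

/-- **Step 2 at the point: the restricted generator generates, so the scalar is `1`.**  The trivialisation
`ψ_k^*κ^*M ≅ ι^*ψ_T^*M ≅ ι^*𝒪 ≅ 𝒪` sends `s′` to `ι^♯(τ(s)) = 1`; applying it to `s′ = c · s′` gives `c = 1`.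
[cite: MumfordAV1970, §12 Thm. 1 (p. 112)] -/
theorem appLE_eq_one_of_squareIso_unitSection_eq_smul (ζ : Γ(T'.left, ⊤))
    (h : ((squareIso (A.whiskerLeft_left_comp_whiskerRight_quotientMk_left T' u K hcov x) M).hom.app
        ((A.quotientMk u K hcov ▷ Over.mk (x ≫ T'.hom)).left ⁻¹ᵁ ⊤)
        (Literature.AlgebraicGeometry.Modules.unitSection (A.X ◁ (Over.homMk x rfl : Over.mk (x ≫ T'.hom) ⟶ T')).left _
          ((A.quotientMk u K hcov ▷ T').left ⁻¹ᵁ ⊤) (τ.inv.app ((A.quotientMk u K hcov ▷ T').left ⁻¹ᵁ ⊤)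
            (1 : Γ((A.X ⊗ T').left, (A.quotientMk u K hcov ▷ T').left ⁻¹ᵁ ⊤))))) =
      (Scheme.Hom.appLE (A.X ◁ (Over.homMk x rfl : Over.mk (x ≫ T'.hom) ⟶ T')).left
        ((A.quotientMk u K hcov ▷ T').left ⁻¹ᵁ ⊤) ((A.quotientMk u K hcov ▷ Over.mk (x ≫ T'.hom)).left ⁻¹ᵁ ⊤) (le_of_eq rfl)
        ((A.quotientMk u K hcov ▷ T').left.app ⊤ ((pullback.snd (A.quotientOver u K).hom T'.hom).appTop ζ))) •
      ((squareIso (A.whiskerLeft_left_comp_whiskerRight_quotientMk_left T' u K hcov x) M).hom.app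
        ((A.quotientMk u K hcov ▷ Over.mk (x ≫ T'.hom)).left ⁻¹ᵁ ⊤)
        (Literature.AlgebraicGeometry.Modules.unitSection (A.X ◁ (Over.homMk x rfl : Over.mk (x ≫ T'.hom) ⟶ T')).left _
          ((A.quotientMk u K hcov ▷ T').left ⁻¹ᵁ ⊤) (τ.inv.app ((A.quotientMk u K hcov ▷ T').left ⁻¹ᵁ ⊤)
            (1 : Γ((A.X ⊗ T').left, (A.quotientMk u K hcov ▷ T').left ⁻¹ᵁ ⊤)))))) :
    (Scheme.Hom.appLE (A.X ◁ (Over.homMk x rfl : Over.mk (x ≫ T'.hom) ⟶ T')).left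
        ((A.quotientMk u K hcov ▷ T').left ⁻¹ᵁ ⊤) ((A.quotientMk u K hcov ▷ Over.mk (x ≫ T'.hom)).left ⁻¹ᵁ ⊤) (le_of_eq rfl)
        ((A.quotientMk u K hcov ▷ T').left.app ⊤ ((pullback.snd (A.quotientOver u K).hom T'.hom).appTop ζ))) = 1 := by
  haveI : IsIso (C := (A.X ⊗ Over.mk (x ≫ T'.hom)).left.Modules)
      (SheafOfModules.pullbackObjUnitToUnit
        (A.X ◁ (Over.homMk x rfl : Over.mk (x ≫ T'.hom) ⟶ T')).left.toRingCatSheafHom) := by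
    haveI := Literature.AlgebraicGeometry.KTheory.final_opensMap (A.X ◁ (Over.homMk x rfl : Over.mk (x ≫ T'.hom) ⟶ T')).left
    exact SheafOfModules.instIsIsoPullbackObjUnitToUnitOfFinal _
  have h3 := congrArg (fun t => Scheme.Modules.Hom.app
      ((squareIso (A.whiskerLeft_left_comp_whiskerRight_quotientMk_left T' u K hcov x) M).inv ≫
        (Scheme.Modules.pullback (A.X ◁ (Over.homMk x rfl : Over.mk (x ≫ T'.hom) ⟶ T')).left).map τ.hom ≫
        SheafOfModules.pullbackObjUnitToUnit
          (A.X ◁ (Over.homMk x rfl : Over.mk (x ≫ T'.hom) ⟶ T')).left.toRingCatSheafHom)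
      ((A.quotientMk u K hcov ▷ Over.mk (x ≫ T'.hom)).left ⁻¹ᵁ ⊤) t) h
  simp only [Scheme.Modules.Hom.app_smul, Scheme.Modules.Hom.comp_app, CategoryTheory.comp_apply] at h3
  have hsq : (squareIso (A.whiskerLeft_left_comp_whiskerRight_quotientMk_left T' u K hcov x) M).inv.app
        ((A.quotientMk u K hcov ▷ Over.mk (x ≫ T'.hom)).left ⁻¹ᵁ ⊤)
        ((squareIso (A.whiskerLeft_left_comp_whiskerRight_quotientMk_left T' u K hcov x) M).hom.app
        ((A.quotientMk u K hcov ▷ Over.mk (x ≫ T'.hom)).left ⁻¹ᵁ ⊤)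
        (Literature.AlgebraicGeometry.Modules.unitSection (A.X ◁ (Over.homMk x rfl : Over.mk (x ≫ T'.hom) ⟶ T')).left _
          ((A.quotientMk u K hcov ▷ T').left ⁻¹ᵁ ⊤) (τ.inv.app ((A.quotientMk u K hcov ▷ T').left ⁻¹ᵁ ⊤)
            (1 : Γ((A.X ⊗ T').left, (A.quotientMk u K hcov ▷ T').left ⁻¹ᵁ ⊤))))) =
      Literature.AlgebraicGeometry.Modules.unitSection (A.X ◁ (Over.homMk x rfl : Over.mk (x ≫ T'.hom) ⟶ T')).left _
        ((A.quotientMk u K hcov ▷ T').left ⁻¹ᵁ ⊤) (τ.inv.app ((A.quotientMk u K hcov ▷ T').left ⁻¹ᵁ ⊤)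
            (1 : Γ((A.X ⊗ T').left, (A.quotientMk u K hcov ▷ T').left ⁻¹ᵁ ⊤))) := by
    rw [← CategoryTheory.comp_apply, ← Scheme.Modules.Hom.comp_app, Iso.hom_inv_id, Scheme.Modules.Hom.id_app]
    rfl
  have hmap : ((Scheme.Modules.pullback (A.X ◁ (Over.homMk x rfl : Over.mk (x ≫ T'.hom) ⟶ T')).left).map τ.hom).app
        ((A.quotientMk u K hcov ▷ Over.mk (x ≫ T'.hom)).left ⁻¹ᵁ ⊤)
        (Literature.AlgebraicGeometry.Modules.unitSection (A.X ◁ (Over.homMk x rfl : Over.mk (x ≫ T'.hom) ⟶ T')).left _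
          ((A.quotientMk u K hcov ▷ T').left ⁻¹ᵁ ⊤) (τ.inv.app ((A.quotientMk u K hcov ▷ T').left ⁻¹ᵁ ⊤)
            (1 : Γ((A.X ⊗ T').left, (A.quotientMk u K hcov ▷ T').left ⁻¹ᵁ ⊤)))) =
      Literature.AlgebraicGeometry.Modules.unitSection (A.X ◁ (Over.homMk x rfl : Over.mk (x ≫ T'.hom) ⟶ T')).left _
        ((A.quotientMk u K hcov ▷ T').left ⁻¹ᵁ ⊤)
        (τ.hom.app ((A.quotientMk u K hcov ▷ T').left ⁻¹ᵁ ⊤) (τ.inv.app ((A.quotientMk u K hcov ▷ T').left ⁻¹ᵁ ⊤)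
            (1 : Γ((A.X ⊗ T').left, (A.quotientMk u K hcov ▷ T').left ⁻¹ᵁ ⊤)))) :=
    pullback_map_app_unitSection (A.X ◁ (Over.homMk x rfl : Over.mk (x ≫ T'.hom) ⟶ T')).left τ.hom
      ((A.quotientMk u K hcov ▷ T').left ⁻¹ᵁ ⊤) _
  have hpbu : Scheme.Modules.Hom.app (SheafOfModules.pullbackObjUnitToUnit
          (A.X ◁ (Over.homMk x rfl : Over.mk (x ≫ T'.hom) ⟶ T')).left.toRingCatSheafHom)
        ((A.quotientMk u K hcov ▷ Over.mk (x ≫ T'.hom)).left ⁻¹ᵁ ⊤)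
        (Literature.AlgebraicGeometry.Modules.unitSection (A.X ◁ (Over.homMk x rfl : Over.mk (x ≫ T'.hom) ⟶ T')).left _
          ((A.quotientMk u K hcov ▷ T').left ⁻¹ᵁ ⊤) (1 : Γ((A.X ⊗ T').left, (A.quotientMk u K hcov ▷ T').left ⁻¹ᵁ ⊤))) =
      (A.X ◁ (Over.homMk x rfl : Over.mk (x ≫ T'.hom) ⟶ T')).left.app ((A.quotientMk u K hcov ▷ T').left ⁻¹ᵁ ⊤)
        (1 : Γ((A.X ⊗ T').left, (A.quotientMk u K hcov ▷ T').left ⁻¹ᵁ ⊤)) :=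
    ActionOver.pullbackObjUnitToUnit_app_unitSection (A.X ◁ (Over.homMk x rfl : Over.mk (x ≫ T'.hom) ⟶ T')).left
      ((A.quotientMk u K hcov ▷ T').left ⁻¹ᵁ ⊤) _
  rw [hsq, hmap, A.hom_app_inv_app_one T' u K hcov M τ] at h3
  have hone : (A.X ◁ (Over.homMk x rfl : Over.mk (x ≫ T'.hom) ⟶ T')).left.app ((A.quotientMk u K hcov ▷ T').left ⁻¹ᵁ ⊤)
      (1 : Γ((A.X ⊗ T').left, (A.quotientMk u K hcov ▷ T').left ⁻¹ᵁ ⊤)) = 1 := map_one _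
  have h4 := (hpbu.trans hone).symm.trans (h3.trans (congrArg (fun t => (Scheme.Hom.appLE (A.X ◁ (Over.homMk x rfl : Over.mk (x ≫ T'.hom) ⟶ T')).left
        ((A.quotientMk u K hcov ▷ T').left ⁻¹ᵁ ⊤) ((A.quotientMk u K hcov ▷ Over.mk (x ≫ T'.hom)).left ⁻¹ᵁ ⊤) (le_of_eq rfl)
        ((A.quotientMk u K hcov ▷ T').left.app ⊤ ((pullback.snd (A.quotientOver u K).hom T'.hom).appTop ζ))) • t) (hpbu.trans hone)))
  have h3' : (1 : Γ((A.X ⊗ Over.mk (x ≫ T'.hom)).left, (A.quotientMk u K hcov ▷ Over.mk (x ≫ T'.hom)).left ⁻¹ᵁ ⊤)) =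
      @HMul.hMul Γ((A.X ⊗ Over.mk (x ≫ T'.hom)).left, (A.quotientMk u K hcov ▷ Over.mk (x ≫ T'.hom)).left ⁻¹ᵁ ⊤) _ _
        instHMul
        (Scheme.Hom.appLE (A.X ◁ (Over.homMk x rfl : Over.mk (x ≫ T'.hom) ⟶ T')).left
        ((A.quotientMk u K hcov ▷ T').left ⁻¹ᵁ ⊤) ((A.quotientMk u K hcov ▷ Over.mk (x ≫ T'.hom)).left ⁻¹ᵁ ⊤) (le_of_eq rfl)
        ((A.quotientMk u K hcov ▷ T').left.app ⊤ ((pullback.snd (A.quotientOver u K).hom T'.hom).appTop ζ)))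
        (1 : Γ((A.X ⊗ Over.mk (x ≫ T'.hom)).left, (A.quotientMk u K hcov ▷ Over.mk (x ≫ T'.hom)).left ⁻¹ᵁ ⊤)) := h4
  rw [mul_one] at h3'
  exact h3'.symm

/-- `ι^♯ ψ_T^♯ pr^♯ ζ = pr_k^♯ (x^♯ ζ)` (the restriction to `A_k` of a function pulled back from `T′` is pulled back from
`Spec k`). [cite: MumfordAV1970, §7 Thm. 4 (p. 72)] -/
theorem appLE_whiskerLeft_app_app_eq (ζ : Γ(T'.left, ⊤)) :
    (Scheme.Hom.appLE (A.X ◁ (Over.homMk x rfl : Over.mk (x ≫ T'.hom) ⟶ T')).left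
        ((A.quotientMk u K hcov ▷ T').left ⁻¹ᵁ ⊤) ((A.quotientMk u K hcov ▷ Over.mk (x ≫ T'.hom)).left ⁻¹ᵁ ⊤) (le_of_eq rfl)
        ((A.quotientMk u K hcov ▷ T').left.app ⊤ ((pullback.snd (A.quotientOver u K).hom T'.hom).appTop ζ))) =
      (pullback.snd A.X.hom (x ≫ T'.hom)).appTop (x.appTop ζ) := by
  have happ : Scheme.Hom.appLE (A.X ◁ (Over.homMk x rfl : Over.mk (x ≫ T'.hom) ⟶ T')).left
        ((A.quotientMk u K hcov ▷ T').left ⁻¹ᵁ ⊤) ((A.quotientMk u K hcov ▷ Over.mk (x ≫ T'.hom)).left ⁻¹ᵁ ⊤) (le_of_eq rfl) =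
      (A.X ◁ (Over.homMk x rfl : Over.mk (x ≫ T'.hom) ⟶ T')).left.app ((A.quotientMk u K hcov ▷ T').left ⁻¹ᵁ ⊤) :=
    Scheme.Hom.appLE_eq_app _
  rw [happ]
  exact congrArg (fun φ => φ.appTop ζ) (A.whiskerLeft_left_comp_comp_snd T' u K hcov x)

include hcov in
/-- **The eigenvalue is `1` at a point where `M` is trivial on the fibre**: if `g · s = ψ_T^♯(pr^♯ ζ) · s` for the
generator `s = τ⁻¹(1)` of `ψ_T^* M` and a global function `ζ` of `T′`, and `M|_{(A/K)_k} ≅ 𝒪` for a field-valued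
point `x : Spec k → T′`, then `ζ(x) = 1` (Steps 1–2, and `pr_k^♯` is injective by ★ Stein).
[cite: MumfordAV1970, §12 Thm. 1 (p. 112)] [cite: MumfordAV1970, §15 Thm. 1 (p. 143)] -/
theorem appTop_eq_one_of_fibre_iso_unit (hM : HasRank M 1) (g : K) (ζ : Γ(T'.left, ⊤))
    (hζ : (translationActionOverWhiskerRight A T' u K hcov).actSections _
        (ActionOver.EquivariantStructure.ofPullback (translationActionOverWhiskerRight A T' u K hcov) M).iso g ⊤
        (τ.inv.app ((A.quotientMk u K hcov ▷ T').left ⁻¹ᵁ ⊤)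
            (1 : Γ((A.X ⊗ T').left, (A.quotientMk u K hcov ▷ T').left ⁻¹ᵁ ⊤))) =
      (A.quotientMk u K hcov ▷ T').left.app ⊤ ((pullback.snd (A.quotientOver u K).hom T'.hom).appTop ζ) •
        (τ.inv.app ((A.quotientMk u K hcov ▷ T').left ⁻¹ᵁ ⊤)
            (1 : Γ((A.X ⊗ T').left, (A.quotientMk u K hcov ▷ T').left ⁻¹ᵁ ⊤))))
    (hx : Nonempty ((Scheme.Modules.pullback
      (A.quotientOver u K ◁ (Over.homMk x rfl : Over.mk (x ≫ T'.hom) ⟶ T')).left).obj M ≅ SheafOfModules.unit _)) :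
    x.appTop ζ = 1 := by
  haveI : IsReduced (Over.mk (x ≫ T'.hom)).left := inferInstanceAs (IsReduced (Spec (.of k)))
  haveI : IsLocallyNoetherian (Over.mk (x ≫ T'.hom)).left := inferInstanceAs (IsLocallyNoetherian (Spec (.of k)))
  have h := A.appLE_eq_one_of_squareIso_unitSection_eq_smul T' u K hcov M τ x ζ
    (A.squareIso_unitSection_eq_smul T' u K hcov M τ x hM g ζ hζ hx)
  rw [A.appLE_whiskerLeft_app_app_eq T' u K hcov x ζ] at h
  apply ((A.baseChange (Over.mk (x ≫ T'.hom)).hom).appTop_bijective_of_isReduced).1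
  rw [map_one]
  exact h

end Point

/-! ## §3 The theorem -/

include hK hfree in
/-- **A line bundle on `(A/K)_T` which is trivial on `A_T` and on one fibre is trivial** (HECKE-LINK D6, (K4)).  Let
`T′ → S` be connected, reduced and locally Noetherian with `n` invertible on it, `K ⊆ A(S)` finite, free and killed by
`n`, `M` a line bundle on `(A/K) ×_S T′` with `ψ_T^* M ≅ 𝒪` and `M|_{(A/K)_k} ≅ 𝒪` for one field-valued point
`x : Spec k → T′`.  Then `M ≅ 𝒪`: the `K`-character of `M` takes values in `n`-th roots of unity of `Γ(T′, 𝒪)`, is `1`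
at `x` (§2), hence `1` (★ `eq_one_of_pow_eq_one_of_appTop_eq_one`), so the generator of `ψ_T^* M` is invariant and ★
`nonempty_iso_unit_of_actSections_eq` applies. [cite: MumfordAV1970, §12 Thm. 1 (p. 112)]
[cite: MumfordAV1970, §15 Thm. 1 (p. 143)] [cite: SGA1, Exp. I Cor. 5.4] -/
theorem nonempty_iso_unit_of_pullback_quotientMk_iso_unit [IsAffine Y] [PreconnectedSpace T'.left] [IsReduced T'.left]
    [IsLocallyNoetherian T'.left] (hn : IsUnit (n : Γ(T'.left, ⊤)))
    (M : ((A.quotientOver u K ⊗ T').left).Modules) (hM : HasRank M 1)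
    (τ : (Scheme.Modules.pullback (A.quotientMk u K hcov ▷ T').left).obj M ≅ SheafOfModules.unit _)
    {k : Type u} [Field k] (x : Spec (.of k) ⟶ T'.left)
    (hx : Nonempty ((Scheme.Modules.pullback
      (A.quotientOver u K ◁ (Over.homMk x rfl : Over.mk (x ≫ T'.hom) ⟶ T')).left).obj M ≅ SheafOfModules.unit _)) :
    Nonempty (M ≅ SheafOfModules.unit _) := by
  haveI : Fintype K := Fintype.ofFinite K
  -- the generator `s = τ⁻¹(1)` of `ψ_T^* M` is invariant
  have hinv : ∀ g : K, (translationActionOverWhiskerRight A T' u K hcov).actSections _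
      (ActionOver.EquivariantStructure.ofPullback (translationActionOverWhiskerRight A T' u K hcov) M).iso g ⊤
      (τ.inv.app ((A.quotientMk u K hcov ▷ T').left ⁻¹ᵁ ⊤)
        (1 : Γ((A.X ⊗ T').left, (A.quotientMk u K hcov ▷ T').left ⁻¹ᵁ ⊤))) =
      τ.inv.app ((A.quotientMk u K hcov ▷ T').left ⁻¹ᵁ ⊤)
        (1 : Γ((A.X ⊗ T').left, (A.quotientMk u K hcov ▷ T').left ⁻¹ᵁ ⊤)) := by
    intro g
    obtain ⟨a, ha⟩ := A.exists_actSections_inv_app_one_eq_smul T' u K hcov M τ g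
    -- `a = ψ_T^♯ pr^♯ ζ` (Stein)
    obtain ⟨ζ, hζ⟩ := ((A.baseChange T'.hom).appTop_bijective_of_isReduced).2 a
    have ha' : a = (A.quotientMk u K hcov ▷ T').left.app ⊤ ((pullback.snd (A.quotientOver u K).hom T'.hom).appTop ζ) := by
      rw [← hζ]
      change _ = ((A.quotientMk u K hcov ▷ T').left ≫ pullback.snd (A.quotientOver u K).hom T'.hom).appTop ζ
      rw [Over.whiskerRight_left_snd]
      rfl
    -- `ζ ^ n = 1`
    have hζn : ζ ^ n = 1 := by
      apply ((A.baseChange T'.hom).appTop_bijective_of_isReduced).1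
      rw [map_pow, map_one, hζ]
      exact A.pow_eq_one_of_actSections_eq_smul T' u K hK hcov M τ g a ha
    -- `ζ(x) = 1`, hence `ζ = 1`
    rw [ha'] at ha
    have hx1 := A.appTop_eq_one_of_fibre_iso_unit T' u K hcov M τ x hM g ζ ha hx
    have hζ1 : ζ = 1 := eq_one_of_pow_eq_one_of_appTop_eq_one T'.left ζ hn hζn x hx1
    rw [ha, hζ1, map_one, map_one, one_smul]
  -- assembly: ★ `nonempty_iso_unit_of_actSections_eq` with `e : ψ_T^* 𝒪 ≅ 𝒪 ≅ ψ_T^* M`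
  haveI : IsIso (C := (A.X ⊗ T').left.Modules)
      (SheafOfModules.pullbackObjUnitToUnit (A.quotientMk u K hcov ▷ T').left.toRingCatSheafHom) := by
    haveI := Literature.AlgebraicGeometry.KTheory.final_opensMap (A.quotientMk u K hcov ▷ T').left
    exact SheafOfModules.instIsIsoPullbackObjUnitToUnitOfFinal _
  haveI := A.flat_whiskerRight_quotientMk_left T' u K hcov hfree
  haveI := isAffineHom_whiskerRight_quotientMk_left A T' u K hcov
  haveI : ((Scheme.Modules.pullback (A.quotientMk u K hcov ▷ T').left).obj M).IsQuasicoherent :=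
    isQuasicoherent_of_hasRank (hasRank_pullback _ hM)
  refine (translationActionOverWhiskerRight A T' u K hcov).nonempty_iso_unit_of_actSections_eq
    (isGeometricQuotient_translationActionOverWhiskerRight A T' u K hcov hfree)
    (translationActionOverWhiskerRight_free A T' u K hcov hfree) M
    (asIso (C := (A.X ⊗ T').left.Modules)
      (SheafOfModules.pullbackObjUnitToUnit (A.quotientMk u K hcov ▷ T').left.toRingCatSheafHom) ≪≫ τ.symm) ?_
  intro g
  have he : ((asIso (C := (A.X ⊗ T').left.Modules)
      (SheafOfModules.pullbackObjUnitToUnit (A.quotientMk u K hcov ▷ T').left.toRingCatSheafHom) ≪≫ τ.symm).hom.app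
        ((A.quotientMk u K hcov ▷ T').left ⁻¹ᵁ ⊤)
        (Literature.AlgebraicGeometry.Modules.unitSection (A.quotientMk u K hcov ▷ T').left (SheafOfModules.unit _) ⊤
          (1 : Γ((A.quotientOver u K ⊗ T').left, ⊤)))) =
      τ.inv.app ((A.quotientMk u K hcov ▷ T').left ⁻¹ᵁ ⊤)
        (1 : Γ((A.X ⊗ T').left, (A.quotientMk u K hcov ▷ T').left ⁻¹ᵁ ⊤)) := by
    change τ.inv.app _ (Scheme.Modules.Hom.app
      (SheafOfModules.pullbackObjUnitToUnit (A.quotientMk u K hcov ▷ T').left.toRingCatSheafHom) _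
        (Literature.AlgebraicGeometry.Modules.unitSection (A.quotientMk u K hcov ▷ T').left (SheafOfModules.unit _) ⊤
          (1 : Γ((A.quotientOver u K ⊗ T').left, ⊤)))) = _
    rw [ActionOver.pullbackObjUnitToUnit_app_unitSection]
    exact congrArg _ (map_one ((A.quotientMk u K hcov ▷ T').left.app ⊤).hom)
  exact (congrArg (fun t => (translationActionOverWhiskerRight A T' u K hcov).actSections _
    (ActionOver.EquivariantStructure.ofPullback (translationActionOverWhiskerRight A T' u K hcov) M).iso g ⊤ t) he).trans
    ((hinv g).trans he.symm)

/-! ## §4 Convenience form: triviality after base change to ANY non-empty `U → T′` -/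

include hK hfree in
/-- **Same, with the fibre hypothesis replaced by triviality over some NON-EMPTY `U → T′`** (the form the (K)/(K5b)
assembly meets: a clopen piece `U` of the test scheme): restrict to the residue field of a point of `U`.
[cite: MumfordAV1970, §15 Thm. 1 (p. 143)] -/
theorem nonempty_iso_unit_of_pullback_quotientMk_iso_unit_of_nonempty [IsAffine Y] [PreconnectedSpace T'.left]
    [IsReduced T'.left] [IsLocallyNoetherian T'.left] (hn : IsUnit (n : Γ(T'.left, ⊤)))
    (M : ((A.quotientOver u K ⊗ T').left).Modules) (hM : HasRank M 1)
    (τ : (Scheme.Modules.pullback (A.quotientMk u K hcov ▷ T').left).obj M ≅ SheafOfModules.unit _)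
    {U : Scheme.{u}} (w : U ⟶ T'.left) [Nonempty U]
    (hU : Nonempty ((Scheme.Modules.pullback
      (A.quotientOver u K ◁ (Over.homMk w rfl : Over.mk (w ≫ T'.hom) ⟶ T')).left).obj M ≅ SheafOfModules.unit _)) :
    Nonempty (M ≅ SheafOfModules.unit _) := by
  obtain ⟨pt⟩ := ‹Nonempty U›
  obtain ⟨e⟩ := hU
  -- the field-valued point `Spec κ(pt) → U → T′` and the base-change square over it
  let x : Spec (U.residueField pt) ⟶ T'.left := U.fromSpecResidueField pt ≫ w
  let j : Over.mk (x ≫ T'.hom) ⟶ Over.mk (w ≫ T'.hom) := Over.homMk (U.fromSpecResidueField pt) rfl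
  have hj : j ≫ (Over.homMk w rfl : Over.mk (w ≫ T'.hom) ⟶ T') = (Over.homMk x rfl : Over.mk (x ≫ T'.hom) ⟶ T') :=
    Over.OverMorphism.ext rfl
  have hcomp : (A.quotientOver u K ◁ j).left ≫ (A.quotientOver u K ◁ (Over.homMk w rfl : Over.mk (w ≫ T'.hom) ⟶ T')).left =
      (A.quotientOver u K ◁ (Over.homMk x rfl : Over.mk (x ≫ T'.hom) ⟶ T')).left := by
    rw [← Over.comp_left, ← MonoidalCategory.whiskerLeft_comp, hj]
  haveI : IsIso (C := (A.quotientOver u K ⊗ Over.mk (x ≫ T'.hom)).left.Modules)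
      (SheafOfModules.pullbackObjUnitToUnit (A.quotientOver u K ◁ j).left.toRingCatSheafHom) := by
    haveI := Literature.AlgebraicGeometry.KTheory.final_opensMap (A.quotientOver u K ◁ j).left
    exact SheafOfModules.instIsIsoPullbackObjUnitToUnitOfFinal _
  exact A.nonempty_iso_unit_of_pullback_quotientMk_iso_unit T' u K hK hcov hfree hn M hM τ x
    ⟨((Scheme.Modules.pullbackCongr hcomp).app M).symm ≪≫
      ((Scheme.Modules.pullbackComp (A.quotientOver u K ◁ j).left
        (A.quotientOver u K ◁ (Over.homMk w rfl : Over.mk (w ≫ T'.hom) ⟶ T')).left).app M).symm ≪≫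
      (Scheme.Modules.pullback (A.quotientOver u K ◁ j).left).mapIso e ≪≫
      asIso (C := (A.quotientOver u K ⊗ Over.mk (x ≫ T'.hom)).left.Modules)
        (SheafOfModules.pullbackObjUnitToUnit (A.quotientOver u K ◁ j).left.toRingCatSheafHom)⟩

end Literature.AlgebraicGeometry.AbelianSchemes.AbelianSchemeOver

end
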